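import Mathlib.Algebra.MvPolynomial.Funext
import Literature.Barriers.ValiantsHypothesis.BILPS19Cor42VerifierSemantics
import Literature.Barriers.ValiantsHypothesis.BIJL18Obs17ClosureProofs
import Literature.Barriers.ValiantsHypothesis.BIJL18CompletionRankNPHardProofs
import HarnessLib

/-!
# Bläser–Ikenmeyer–Jindal–Lysikov 2018, Thm 4: the `∃BPP` verifier's two identity-test
# instances — layout, semantics, soundness and completeness at the level of guessed blocks

Theorem-only companion of `BIJL18MatrixCompletion.lean` (typed fact `BIJL2018_thm4 K`: "for
infinitely many `n`, there is … a tensor `t` with coefficients in `{−1, 0, 1}` and a value `r` such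
that there is no algebraic `poly(n)`-natural proof for `\underline{CR}(t) > r` unless
`coNP ⊆ ∃BPP`", ECCC TR18-064 Thm 4, proof pp. 11–12). The printed proof puts the complement of
Max-2-SAT in `∃BPP`: on the tensor `T_φ` of Thm 3 (`r = 2s − b`), "(1) Guess a circuit `C` of
polynomial size computing a polynomial `p`. (2) Decide whether `p(g) = 0` using polynomial identity
testing. (3) Check whether `p(T_φ) ≠ 0`", where `g` is the parametrisation of Lemma 16. This file
writes, for a tensor instance `(n, m, entries, r)` and a guessed gate list, the two division-free
INTEGER circuits whose identity tests the verifier runs, proves what they compute, and proves the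
block-level soundness / completeness of the two tests over every field of characteristic `0`:

* the guessed circuit is a gate list `B : KBlock` of the tree's Kabanets–Impagliazzo machinery
  (`KIReductionInstance.lean`: `blockPoly N B`), exactly as in the sibling verifier of BILPS Cor 42
  (`BILPS19Cor42VerifierSemantics.lean`, whose tools `useGatesRef`, `evalCircuit`,
  `exists_kblock_of_circuit` are used by name);
* `chartCircuit n m r B` — the identity-test instance "`p(g)`": in the parameter variables
  `U₀, V₀ ∈ K^{r×n}`, `U_k, V_k ∈ K^{n×n}`, `z ∈ K^m` of Lemma 16 (rank profile `r₀ = r`, `r_k = n`,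
  i.e. NO constraint on the slice ranks — the typed natural proofs vanish on ALL tensors of border
  completion rank `≤ r`; disclosed deviation from print, which takes `r_k = rk A_k`) it computes
  `blockPoly` composed with the coordinates of `g` (`eval_chartCircuit`), and it vanishes iff
  `p ∘ g = 0` for the guessed polynomial `p` read over `K` (`eval_chartCircuit_eq_zero_iff`);
* the evaluation instance is the sibling's `evalCircuit N entries B` ("`p(T_φ) ≠ 0` can again be
  checked by polynomial identity testing");
* SOUNDNESS (`lt_borderCompletionRank_of_tests`): chart test `≡ 0` and evaluation `≢ 0` force
  `r < \underline{CR}` of the instance tensor (Lemma 16 / Obs 17: `p ∘ g = 0` ⇒ `p` vanishes on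
  `C^{n,m,n}_r = {\underline{CR} ≤ r}`, t23's `eval_eq_zero_of_mem_bijlVariety`); COMPLETENESS
  (`exists_block_of_isBorderCRProof`): a typed natural proof `IsBorderCRProof K A₀ A r s p` of the
  instance tensor descends to a guessed block of length `≤ s + 1` passing both tests;
* the Max-2-SAT end (`§6`): padding a 2-CNF by tautological clauses `(x₀ ∨ ¬x₀)` (so that the
  tensor `T_φ` is as large as the natural-proof hypothesis wants, in place of print's "let `n` be
  large enough"), and the sign pattern of the entries of `T_φ`.

The string machine writing the two code words and the `∃·BPP` assembly
(`BIJL2018_thm4` for fields of characteristic `0` from `PITLanguage ∈ BPP`) are the sibling files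
`BIJL18Thm4Machine.lean` / `BIJL18Thm4OfPIT.lean`. Theorem-only file (its `def`s are proof
plumbing: layouts and gate lists); no statement of the barrier file is touched, no new fact.
HONEST FRAMING (val-lit): Boolean/algebraic plumbing of a printed `∃BPP` verifier for a 2018
CONDITIONAL barrier about the varieties `{\underline{CR} ≤ r}`; `VP ≠ VNP` is NOT proved and
nothing here bears on it.

## References

* [BlaserIkenmeyerJindalLysikov2018] M. Bläser, C. Ikenmeyer, G. Jindal, V. Lysikov, *Generalized
  matrix completion and algebraic natural proofs*, STOC 2018 / ECCC TR18-064: Thm 4 (proof,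
  ECCC pp. 11–12), Obs 15, Lemma 16, Obs 17, Thm 3 / Lemma 14.
* [BlaserIkenmeyerLysikovPandeySchreyer2019] arXiv:1911.02534, §8.3 Thm 40 (proof) — the same
  verifier shape for minrank (tree: `BILPS19Cor42VerifierSemantics.lean`).
* [KabanetsImpagliazzo2003] V. Kabanets, R. Impagliazzo, STOC 2003, proof of Cor. 12 (p. 358)
  (guessed gate lists).
* [Burgisser2000] P. Bürgisser, *Completeness and Reduction in Algebraic Complexity Theory*,
  Springer 2000, Def. 2.1, Rem. 2.7 (straight-line programs, substitution).
-/

noncomputable section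

open MvPolynomial

namespace Literature.Barriers.ValiantsHypothesis

namespace BIJL2018Thm4

open Literature.Computability.AlgebraicComplexity ArithCircuit KIReduction BILPS2019Cor42

universe u

/-! ### §1. Layout: input positions and the Lemma-16 parameter variables -/

section Layout

variable (n m r : ℕ)

/-- Number of tensor coordinates / input positions of the guessed block: `N = (m+1) n²`
(constant slice first; position of `(h, i, j)` is `h n² + i n + j`, the row-major order of the
instance encoding `tensorInstEncoding`). [cite: BlaserIkenmeyerJindalLysikov2018, §1.4 (input)] -/
def nPos : ℕ := (m + 1) * n ^ 2

/-- Number of variables of the chart test: `U₀, V₀` (`r n` each), `U_k, V_k` (`m n²` each, slice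
rank profile `r_k = n`), `z` (`m`). [cite: BlaserIkenmeyerJindalLysikov2018, Obs. 17 (the parameters of g)] -/
def nVar : ℕ := 2 * (r * n) + 2 * (m * n ^ 2) + m

/-- Index of `(U₀)_{a i}`. [folklore] -/
def u0Idx (a i : ℕ) : ℕ := a * n + i

/-- Index of `(V₀)_{a j}`. [folklore] -/
def v0Idx (a j : ℕ) : ℕ := r * n + (a * n + j)

/-- Index of `(U_k)_{a i}`. [folklore] -/
def uIdx (k a i : ℕ) : ℕ := 2 * (r * n) + ((k * n + a) * n + i)

/-- Index of `(V_k)_{a j}`. [folklore] -/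
def vIdx (k a j : ℕ) : ℕ := 2 * (r * n) + m * n ^ 2 + ((k * n + a) * n + j)

/-- Index of `z_k`. [folklore] -/
def zIdx (k : ℕ) : ℕ := 2 * (r * n) + 2 * (m * n ^ 2) + k

end Layout

/-! ### §2. The chart-test circuit "`p(g)`" -/

section Chart

variable (n m r : ℕ)

/-- Product gate `(U₀)_{a i} (V₀)_{a j}` for input position `v` (`i = (v / n) % n`, `j = v % n`).
[cite: BlaserIkenmeyerJindalLysikov2018, Obs. 15 and Lemma 16] -/
def prodU0V0 (v a : ℕ) : Gate ℤ (Fin (nVar n m r)) :=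
  .prod [varOp _ (u0Idx n a ((v / n) % n)), varOp _ (v0Idx n r a (v % n))]

/-- Product gate `z_k (U_k)_{a i} (V_k)_{a j}` for input position `v`, pair index `q = k n + a`.
[cite: BlaserIkenmeyerJindalLysikov2018, Lemma 16] -/
def prodZUV (v q : ℕ) : Gate ℤ (Fin (nVar n m r)) :=
  .prod [varOp _ (zIdx n m r (q / n)), varOp _ (uIdx n r (q / n) (q % n) ((v / n) % n)),
    varOp _ (vIdx n m r (q / n) (q % n) (v % n))]

/-- Product gate `(U_k)_{a i} (V_k)_{a j}` for input position `v` with `k = v / n² − 1` (the slice of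
the position; junk but harmless on the constant slice). [cite: BlaserIkenmeyerJindalLysikov2018, Obs. 15] -/
def prodUV (v a : ℕ) : Gate ℤ (Fin (nVar n m r)) :=
  .prod [varOp _ (uIdx n r (v / n ^ 2 - 1) a ((v / n) % n)), varOp _ (vIdx n m r (v / n ^ 2 - 1) a (v % n))]

/-- The product gates of input position `v`: `r` of kind `U₀V₀`, `m n` of kind `zUV`, `n` of kind
`UV` (all value-independent). [cite: BlaserIkenmeyerJindalLysikov2018, Lemma 16] -/
def prods (v : ℕ) : List (Gate ℤ (Fin (nVar n m r))) :=
  (List.range r).map (prodU0V0 n m r v) ++ (List.range (m * n)).map (prodZUV n m r v) ++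
    (List.range n).map (prodUV n m r v)

/-- Length of the product gates. [cite: Burgisser2000, Def. 2.1] -/
@[simp] theorem length_prods (v : ℕ) : (prods n m r v).length = r + m * n + n := by
  simp [prods, Nat.add_assoc]

/-- The coordinate gate of input position `v`, its products sitting at `p, p + 1, …`: on the
constant slice (`v / n² = 0`) the entry `(U₀ᵀV₀ − Σ_k z_k U_kᵀV_k)_{ij}`, on slice `k+1` the entry
`(U_kᵀ V_k)_{ij}`. [cite: BlaserIkenmeyerJindalLysikov2018, Lemma 16 (the map g)] -/
def coordGate (v p : ℕ) : Gate ℤ (Fin (nVar n m r)) :=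
  if v / n ^ 2 = 0 then
    .sum ((List.range r).map (fun a => ((1 : ℤ), .gate (p + a))) ++
      (List.range (m * n)).map (fun q => ((-1 : ℤ), .gate (p + r + q))))
  else .sum ((List.range n).map fun a => ((1 : ℤ), .gate (p + (r + m * n) + a)))

/-- The block of input position `v` placed at `p`: products then the coordinate gate.
[cite: BlaserIkenmeyerJindalLysikov2018, Lemma 16] -/
def coordBlock (v p : ℕ) : List (Gate ℤ (Fin (nVar n m r))) :=
  prods n m r v ++ [coordGate n m r v p]

/-- Length of one coordinate block. [cite: Burgisser2000, Def. 2.1] -/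
def blockLen : ℕ := r + m * n + n + 1

/-- Length of a coordinate block. [cite: Burgisser2000, Def. 2.1] -/
@[simp] theorem length_coordBlock (v p : ℕ) : (coordBlock n m r v p).length = blockLen n m r := by
  simp [coordBlock, blockLen]

/-- All coordinate blocks (input positions `0, …, M−1`), starting at `base`.
[cite: BlaserIkenmeyerJindalLysikov2018, Lemma 16] -/
def coords (base M : ℕ) : List (Gate ℤ (Fin (nVar n m r))) :=
  (List.range M).flatMap fun v => coordBlock n m r v (base + v * blockLen n m r)

/-- Length of the coordinate gates. [cite: Burgisser2000, Def. 2.1] -/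
@[simp] theorem length_coords (base M : ℕ) : (coords n m r base M).length = M * blockLen n m r := by
  induction M with
  | zero => simp [coords]
  | succ M ih =>
    simp only [coords, List.range_succ, List.flatMap_append, List.flatMap_singleton, List.length_append,
      length_coordBlock] at ih ⊢
    rw [ih]; ring

/-- Position of the coordinate gate of input `v` among coordinates starting at `base`. [folklore] -/
def coordRef (base v : ℕ) : ℕ := base + v * blockLen n m r + (r + m * n + n)

/-- **The chart-test circuit** of the guessed block `B`: the coordinate blocks, a use of `B` behind
the coordinate gates, and a ballast of `nVar` empty gates (so that the code word is at least as long
as the number of variables — the side condition of the tree's identity test on circuit codes).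
[cite: BlaserIkenmeyerJindalLysikov2018, Thm. 4 (proof, step (2): "Decide whether p(g) = 0 using polynomial identity testing")] -/
def chartCircuit (B : KBlock) : ArithCircuit ℤ (Fin (nVar n m r)) where
  gates := coords n m r 0 (nPos n m) ++
    useGatesRef (nPos n m * blockLen n m r) (coordRef n m r 0) (nPos n m) B ++
    ballast (nVar n m r) (nVar n m r)
  output := .gate (nPos n m * blockLen n m r + useOut (nPos n m) B)

/-! #### Semantics of the chart-test circuit -/

/-- The polynomial of the coordinate at input position `v` (`h = v / n²`, `i = (v / n) % n`,
`j = v % n`): `Σ_{a<r} (U₀)_{ai}(V₀)_{aj} − Σ_{k<m} Σ_{a<n} z_k (U_k)_{ai} (V_k)_{aj}` if `h = 0`,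
else `Σ_{a<n} (U_{h−1})_{ai} (V_{h−1})_{aj}`.
[cite: BlaserIkenmeyerJindalLysikov2018, Lemma 16 (the map g)] -/
def coordPoly (v : ℕ) : MvPolynomial (Fin (nVar n m r)) ℤ :=
  if v / n ^ 2 = 0 then
    (∑ a : Fin r, varP _ (u0Idx n a ((v / n) % n)) * varP _ (v0Idx n r a (v % n))) -
      ∑ k : Fin m, ∑ a : Fin n, varP _ (zIdx n m r k) *
        varP _ (uIdx n r k a ((v / n) % n)) * varP _ (vIdx n m r k a (v % n))
  else ∑ a : Fin n, varP _ (uIdx n r (v / n ^ 2 - 1) a ((v / n) % n)) *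
    varP _ (vIdx n m r (v / n ^ 2 - 1) a (v % n))

/-- The values of the product gates of input position `v`. [folklore] -/
def prodVals (v : ℕ) : List (MvPolynomial (Fin (nVar n m r)) ℤ) :=
  (List.range r).map (fun a => varP _ (u0Idx n a ((v / n) % n)) * varP _ (v0Idx n r a (v % n))) ++
    (List.range (m * n)).map (fun q => varP _ (zIdx n m r (q / n)) *
      varP _ (uIdx n r (q / n) (q % n) ((v / n) % n)) * varP _ (vIdx n m r (q / n) (q % n) (v % n))) ++
    (List.range n).map (fun a => varP _ (uIdx n r (v / n ^ 2 - 1) a ((v / n) % n)) *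
      varP _ (vIdx n m r (v / n ^ 2 - 1) a (v % n)))

/-- Length of the product values. [cite: Burgisser2000, Def. 2.1] -/
@[simp] theorem length_prodVals (v : ℕ) : (prodVals n m r v).length = r + m * n + n := by
  simp [prodVals, Nat.add_assoc]

/-- The values of a coordinate block: the products and the coordinate. [folklore] -/
def coordBlockVals (v : ℕ) : List (MvPolynomial (Fin (nVar n m r)) ℤ) :=
  prodVals n m r v ++ [coordPoly n m r v]

/-- Length of the values of a coordinate block. [cite: Burgisser2000, Def. 2.1] -/
@[simp] theorem length_coordBlockVals (v : ℕ) : (coordBlockVals n m r v).length = blockLen n m r := by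
  simp [coordBlockVals, blockLen]

/-- Appending value-independent gates appends their (fixed) values. [folklore] -/
private theorem gateValues_append_of_forall (pre gs : List (Gate ℤ (Fin (nVar n m r))))
    (f : Gate ℤ (Fin (nVar n m r)) → MvPolynomial (Fin (nVar n m r)) ℤ)
    (h : ∀ g ∈ gs, ∀ vals, g.eval vals = f g) : gateValues (pre ++ gs) = gateValues pre ++ gs.map f := by
  induction gs using List.reverseRecOn with
  | nil => simp
  | append_singleton gs g ih =>
    rw [← List.append_assoc, gateValues_append_singleton, ih (fun g' hg' => h g' (by simp [hg'])),
      List.map_append, List.map_singleton, List.append_assoc, h g (by simp)]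

/-- The product gates are value-independent and compute `prodVals`. [folklore] -/
private theorem gateValues_append_prods (pre : List (Gate ℤ (Fin (nVar n m r)))) (v : ℕ) :
    gateValues (pre ++ prods n m r v) = gateValues pre ++ prodVals n m r v := by
  rw [gateValues_append_of_forall n m r pre _ (fun g => g.eval []) (fun g hg vals => ?_)]
  · simp [prods, prodVals, prodU0V0, prodZUV, prodUV, Gate.eval, Function.comp_def, mul_assoc]
  · simp only [prods, List.mem_append, List.mem_map, List.mem_range] at hg
    rcases hg with (⟨a, -, rfl⟩ | ⟨q, -, rfl⟩) | ⟨a, -, rfl⟩ <;> simp [prodU0V0, prodZUV, prodUV, Gate.eval]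

/-- Reading position `V.length + j` of `V ++ W`. [folklore] -/
private theorem getD_append_right' (V W : List (MvPolynomial (Fin (nVar n m r)) ℤ)) (j : ℕ) :
    (V ++ W).getD (V.length + j) 0 = W.getD j 0 := by
  rw [List.getD_eq_getElem?_getD, List.getD_eq_getElem?_getD, List.getElem?_append_right (by omega),
    Nat.add_sub_cancel_left]

/-- A sum of list-indexed gate references over `range`, read as a `Finset` sum. [folklore] -/
private theorem sum_map_range_smul_gate (vals : List (MvPolynomial (Fin (nVar n m r)) ℤ)) (c : ℤ)
    (f : ℕ → ℕ) (M : ℕ) :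
    (((List.range M).map fun a => (c, (Operand.gate (f a) : Operand ℤ (Fin (nVar n m r))))).map
        (fun a => a.1 • a.2.eval vals)).sum = ∑ a ∈ Finset.range M, c • vals.getD (f a) 0 := by
  rw [List.map_map, ← List.toFinset_range, List.sum_toFinset _ List.nodup_range]
  rfl

/-- Sums over `q < m n` read as double sums over `(q / n, q % n)`. [folklore] -/
private theorem sum_fin_mul_eq_sum_sum {β : Type*} [AddCommMonoid β] (m n : ℕ) (G : ℕ → ℕ → β) :
    ∑ q : Fin (m * n), G (q.1 / n) (q.1 % n) = ∑ k : Fin m, ∑ a : Fin n, G k a := by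
  rw [← Equiv.sum_comp finProdFinEquiv (fun q : Fin (m * n) => G (q.1 / n) (q.1 % n)), Fintype.sum_prod_type]
  refine Finset.sum_congr rfl fun k _ => Finset.sum_congr rfl fun a _ => ?_
  have hn : 0 < n := Nat.pos_of_ne_zero fun h => by subst h; exact absurd a.isLt (Nat.not_lt_zero _)
  simp only [finProdFinEquiv_apply_val]
  rw [Nat.add_mul_div_left _ _ hn, Nat.div_eq_of_lt a.isLt, Nat.zero_add, Nat.add_mul_mod_self_left,
    Nat.mod_eq_of_lt a.isLt]

/-- **The coordinate gate computes the coordinate polynomial** when its products sit right before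
it. [cite: BlaserIkenmeyerJindalLysikov2018, Lemma 16 (the map g)] -/
theorem eval_coordGate (V : List (MvPolynomial (Fin (nVar n m r)) ℤ)) (v : ℕ) :
    (coordGate n m r v V.length).eval (V ++ prodVals n m r v) = coordPoly n m r v := by
  have hget : ∀ j, (V ++ prodVals n m r v).getD (V.length + j) 0 = (prodVals n m r v).getD j 0 :=
    getD_append_right' n m r V _
  have hA : ∀ a < r, (prodVals n m r v).getD a 0 =
      varP _ (u0Idx n a ((v / n) % n)) * varP _ (v0Idx n r a (v % n)) := fun a ha => by
    rw [prodVals, List.append_assoc, List.getD_eq_getElem?_getD, List.getElem?_append_left (by simpa using ha)]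
    simp [List.getElem?_range ha]
  have hB : ∀ q < m * n, (prodVals n m r v).getD (r + q) 0 = varP _ (zIdx n m r (q / n)) *
      varP _ (uIdx n r (q / n) (q % n) ((v / n) % n)) * varP _ (vIdx n m r (q / n) (q % n) (v % n)) := fun q hq => by
    rw [prodVals, List.append_assoc, List.getD_eq_getElem?_getD,
      List.getElem?_append_right (by simp), List.length_map, List.length_range, Nat.add_sub_cancel_left,
      List.getElem?_append_left (by simpa using hq)]
    simp [List.getElem?_range hq]
  have hC : ∀ a < n, (prodVals n m r v).getD (r + m * n + a) 0 =
      varP _ (uIdx n r (v / n ^ 2 - 1) a ((v / n) % n)) * varP _ (vIdx n m r (v / n ^ 2 - 1) a (v % n)) := fun a ha => by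
    rw [prodVals, List.getD_eq_getElem?_getD, List.getElem?_append_right (by simp)]
    simp [List.getElem?_range ha]
  unfold coordGate coordPoly
  split_ifs with h
  · simp only [Gate.eval, List.map_append, List.sum_append]
    rw [sum_map_range_smul_gate, sum_map_range_smul_gate, sub_eq_add_neg, Finset.sum_range, Finset.sum_range,
      ← sum_fin_mul_eq_sum_sum m n (fun k a => varP _ (zIdx n m r k) * varP _ (uIdx n r k a ((v / n) % n)) *
        varP _ (vIdx n m r k a (v % n))), ← Finset.sum_neg_distrib]
    congr 1
    · exact Finset.sum_congr rfl fun a _ => by rw [hget, hA a a.isLt, one_smul]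
    · exact Finset.sum_congr rfl fun q _ => by
        rw [Nat.add_assoc, hget, hB q q.isLt, neg_one_zsmul]
  · simp only [Gate.eval]
    rw [sum_map_range_smul_gate, Finset.sum_range]
    exact Finset.sum_congr rfl fun a _ => by rw [Nat.add_assoc, hget, hC a a.isLt, one_smul]

/-- **Values of a coordinate block** placed at its own position. [folklore] -/
private theorem gateValues_append_coordBlock (pre : List (Gate ℤ (Fin (nVar n m r)))) (v : ℕ) :
    gateValues (pre ++ coordBlock n m r v pre.length) = gateValues pre ++ coordBlockVals n m r v := by
  rw [coordBlock, ← List.append_assoc, gateValues_append_singleton, gateValues_append_prods, coordBlockVals,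
    List.append_assoc]
  have hlen : (gateValues pre).length = pre.length := gateValues_length pre
  congr 2
  have := eval_coordGate n m r (gateValues pre) v
  rw [hlen] at this
  rw [this]

/-- Unfolding `coords` by one input position. [cite: BlaserIkenmeyerJindalLysikov2018, Lemma 16] -/
theorem coords_succ (base M : ℕ) :
    coords n m r base (M + 1) = coords n m r base M ++ coordBlock n m r M (base + M * blockLen n m r) := by
  simp [coords, List.range_succ, List.flatMap_append]

/-- **Values of the coordinate gates** placed at their own position. [folklore] -/
private theorem gateValues_append_coords (pre : List (Gate ℤ (Fin (nVar n m r)))) (M : ℕ) :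
    gateValues (pre ++ coords n m r pre.length M) =
      gateValues pre ++ (List.range M).flatMap (coordBlockVals n m r) := by
  induction M with
  | zero => simp [coords]
  | succ M ih =>
    rw [coords_succ, ← List.append_assoc,
      show pre.length + M * blockLen n m r = (pre ++ coords n m r pre.length M).length by simp,
      gateValues_append_coordBlock, ih, List.range_succ, List.flatMap_append, List.flatMap_singleton,
      List.append_assoc]

/-- Reading inside a concatenation of blocks of constant length. [folklore] -/
private theorem getD_flatMap_range {α : Type*} (f : ℕ → List α) {L : ℕ} (hf : ∀ i, (f i).length = L) (d : α)
    {M i j : ℕ} (hi : i < M) (hj : j < L) :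
    ((List.range M).flatMap f).getD (i * L + j) d = (f i).getD j d := by
  induction M with
  | zero => exact absurd hi (Nat.not_lt_zero _)
  | succ M ih =>
    have hlen : ((List.range M).flatMap f).length = M * L := by
      clear hi ih
      induction M with
      | zero => simp
      | succ M ih => simp [List.range_succ, List.flatMap_append, ih, hf]; ring
    rw [List.range_succ, List.flatMap_append, List.flatMap_singleton, List.getD_eq_getElem?_getD,
      List.getD_eq_getElem?_getD]
    rcases Nat.lt_succ_iff_lt_or_eq.1 hi with h | rfl
    · rw [List.getElem?_append_left (by rw [hlen]; nlinarith), ← List.getD_eq_getElem?_getD,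
        ← List.getD_eq_getElem?_getD, ih h]
    · rw [List.getElem?_append_right (by rw [hlen]; omega), hlen, Nat.add_sub_cancel_left]

/-- **The coordinate gate of input `v` holds `coordPoly v`.** [cite: BlaserIkenmeyerJindalLysikov2018, Lemma 16] -/
theorem valueAt_coords (pre post : List (Gate ℤ (Fin (nVar n m r)))) {M v : ℕ} (hv : v < M) :
    valueAt (pre ++ coords n m r pre.length M ++ post) (coordRef n m r pre.length v) = coordPoly n m r v := by
  have hlt : coordRef n m r pre.length v < (pre ++ coords n m r pre.length M).length := by
    simp only [coordRef, List.length_append, length_coords]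
    have : (v + 1) * blockLen n m r ≤ M * blockLen n m r := Nat.mul_le_mul_right _ hv
    simp only [blockLen] at this ⊢
    nlinarith
  rw [valueAt_append_left _ _ hlt, valueAt, gateValues_append_coords, coordRef, Nat.add_assoc,
    List.getD_eq_getElem?_getD, List.getElem?_append_right (by rw [gateValues_length]; omega), gateValues_length,
    Nat.add_sub_cancel_left, ← List.getD_eq_getElem?_getD,
    getD_flatMap_range (coordBlockVals n m r) (L := blockLen n m r) (length_coordBlockVals n m r) 0 hv
      (by simp [blockLen])]
  simp [coordBlockVals, List.getD_eq_getElem?_getD]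

/-- **The chart-test circuit computes `blockPoly` at the coordinates of `g`.**
[cite: BlaserIkenmeyerJindalLysikov2018, Thm. 4 (proof, step (2): "p(g)")] -/
theorem eval_chartCircuit (B : KBlock) :
    (chartCircuit n m r B).eval =
      aeval (fun i : Fin (nPos n m) => coordPoly n m r i) (blockPoly (nPos n m) B) := by
  change (Operand.gate (nPos n m * blockLen n m r + useOut (nPos n m) B) : Operand ℤ _).eval
    (gateValues (coords n m r 0 (nPos n m) ++
      useGatesRef (nPos n m * blockLen n m r) (coordRef n m r 0) (nPos n m) B ++ ballast (nVar n m r) (nVar n m r))) = _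
  rw [eval_gate_eq_valueAt]
  have hpre : (coords n m r 0 (nPos n m)).length = nPos n m * blockLen n m r := by simp
  rw [← hpre, valueAt_useGatesRef _ _ (fun i hi => ?_) B]
  · have hfun : (fun i : Fin (nPos n m) => valueAt (coords n m r 0 (nPos n m)) (coordRef n m r 0 i.1)) =
        fun i : Fin (nPos n m) => coordPoly n m r i.1 := funext fun i => by
      have h := valueAt_coords n m r [] [] (M := nPos n m) (v := i.1) i.isLt
      simpa using h
    rw [hfun]
  · simp only [coordRef, length_coords]
    have : (i + 1) * blockLen n m r ≤ nPos n m * blockLen n m r := Nat.mul_le_mul_right _ hi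
    simp only [blockLen] at this ⊢
    nlinarith

/-- Size of the chart-test circuit. [cite: Burgisser2000, Def. 2.1] -/
theorem size_chartCircuit (B : KBlock) :
    (chartCircuit n m r B).size = nPos n m * blockLen n m r + (nPos n m + B.length + 1) + nVar n m r := by
  simp only [chartCircuit, size, ballast, List.length_append, length_coords, length_useGatesRef,
    List.length_replicate]

end Chart

/-! ### §3. Positions and parameters as `Fin` variables; the chart test against the map `g` of Lemma 16 -/

section Link

variable (n m r : ℕ)

/-- **The position equivalence** `Option (Fin m) × Fin n × Fin n ≃ Fin ((m+1) n²)`: the constant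
slice `none` first, then slice `k` as block `k + 1`; inside a slice row-major (the order of the
instance encoding). [cite: BlaserIkenmeyerJindalLysikov2018, §1.4 (input)] -/
def posEquiv : (Option (Fin m) × Fin n × Fin n) ≃ Fin (nPos n m) :=
  ((Equiv.prodCongr (finSuccEquiv m).symm finProdFinEquiv).trans finProdFinEquiv).trans
    (finCongr (by unfold nPos; ring))

/-- The slice number of a coordinate: `none ↦ 0`, `some k ↦ k + 1`. [cite: BlaserIkenmeyerJindalLysikov2018, §1.4] -/
def sliceIdx : Option (Fin m) → ℕ
  | none => 0
  | some k => k.1 + 1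

/-- **Value of the position equivalence**: `(h, i, j) ↦ h n² + i n + j`.
[cite: BlaserIkenmeyerJindalLysikov2018, §1.4 (input)] -/
theorem posEquiv_apply_val (v : Option (Fin m) × Fin n × Fin n) :
    (posEquiv n m v).1 = sliceIdx m v.1 * n ^ 2 + v.2.1.1 * n + v.2.2.1 := by
  obtain ⟨_ | k, i, j⟩ := v
  · simp [posEquiv, sliceIdx]; ring
  · simp [posEquiv, sliceIdx, Fin.val_succ]; ring

variable {n m} in
/-- Decoding a position: slice, row and column. [cite: BlaserIkenmeyerJindalLysikov2018, §1.4 (input)] -/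
theorem posEquiv_div_mod (v : Option (Fin m) × Fin n × Fin n) :
    (posEquiv n m v).1 / n ^ 2 = sliceIdx m v.1 ∧ (posEquiv n m v).1 / n % n = v.2.1.1 ∧
      (posEquiv n m v).1 % n = v.2.2.1 := by
  obtain ⟨h, i, j⟩ := v
  have hn : 0 < n := Nat.pos_of_ne_zero fun h0 => by subst h0; exact absurd i.isLt (Nat.not_lt_zero _)
  have hij : i.1 * n + j.1 < n ^ 2 := by have := i.isLt; have := j.isLt; nlinarith
  rw [posEquiv_apply_val]
  refine ⟨?_, ?_, ?_⟩
  · rw [Nat.add_assoc, Nat.add_comm, Nat.add_mul_div_right _ _ (pow_pos hn 2), Nat.div_eq_of_lt hij, Nat.zero_add]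
  · rw [show sliceIdx m h * n ^ 2 + i.1 * n + j.1 = j.1 + (i.1 + sliceIdx m h * n) * n by ring,
      Nat.add_mul_div_right _ _ hn, Nat.div_eq_of_lt j.isLt, Nat.zero_add, Nat.add_mul_mod_self_right,
      Nat.mod_eq_of_lt i.isLt]
  · rw [show sliceIdx m h * n ^ 2 + i.1 * n + j.1 = j.1 + (i.1 + sliceIdx m h * n) * n by ring,
      Nat.add_mul_mod_self_right, Nat.mod_eq_of_lt j.isLt]

variable (K : Type u) [Field K]

/-- **The instance entries by input position** (junk `0` beyond the list): the constant layer of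
the evaluation circuit `evalCircuit (nPos n m) (entryFn l) B`. [cite: BlaserIkenmeyerJindalLysikov2018, §1.4 (input)] -/
def entryFn (l : List ℤ) (v : ℕ) : ℤ := l.getD v 0

variable {n m} in
/-- **Reading the instance tensor by position**: the coordinate `v` of the tensor
`(slice₀OfList, slicesOfList)` of an entry list `l` is the entry `l[posEquiv v]` (junk `0` beyond
the list). [cite: BlaserIkenmeyerJindalLysikov2018, §1.4 (input)] -/
theorem tensorPoint_ofList (l : List ℤ) (v : Option (Fin m) × Fin n × Fin n) :
    tensorPoint K (slice₀OfList K n l) (slicesOfList K n m l) v = ((entryFn l (posEquiv n m v).1 : ℤ) : K) := by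
  rw [posEquiv_apply_val, entryFn]
  obtain ⟨_ | k, i, j⟩ := v
  · simp [tensorPoint, slice₀OfList, sliceIdx]
  · simp [tensorPoint, slicesOfList, sliceIdx]

/-- **The layout equivalence** of the Lemma-16 parameters (slice-rank profile `r_k = n`) with the
chart-test variables: `(U₀)_{ai} ↦ a n + i`, `(V₀)_{aj} ↦ r n + a n + j`, `(U_k)_{ai} ↦ 2rn + k n² + a n + i`,
`(V_k)_{aj} ↦ 2rn + m n² + k n² + a n + j`, `z_k ↦ 2rn + 2mn² + k`.
[cite: BlaserIkenmeyerJindalLysikov2018, Obs. 17 (the parameters of g)] -/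
def layoutEquiv : Lemma16Params n m n r ≃ Fin (nVar n m r) :=
  ((Equiv.sumCongr (Equiv.sumCongr finProdFinEquiv finProdFinEquiv)
      (Equiv.sumCongr
        (Equiv.sumCongr (((Equiv.prodCongr (Equiv.refl (Fin m)) finProdFinEquiv)).trans finProdFinEquiv)
          (((Equiv.prodCongr (Equiv.refl (Fin m)) finProdFinEquiv)).trans finProdFinEquiv))
        (Equiv.refl (Fin m)))).trans
    ((Equiv.sumCongr finSumFinEquiv ((Equiv.sumCongr finSumFinEquiv (Equiv.refl _)).trans finSumFinEquiv)).trans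
      finSumFinEquiv)).trans
    (finCongr (by unfold nVar; ring))

/-- Layout of `(U₀)_{ai}`. [cite: BlaserIkenmeyerJindalLysikov2018, Obs. 17] -/
@[simp] theorem layoutEquiv_u0 (a : Fin r) (i : Fin n) :
    (layoutEquiv n m r (Sum.inl (Sum.inl (a, i)))).1 = u0Idx n a i := by
  simp [layoutEquiv, u0Idx]; ring

/-- Layout of `(V₀)_{aj}`. [cite: BlaserIkenmeyerJindalLysikov2018, Obs. 17] -/
@[simp] theorem layoutEquiv_v0 (a : Fin r) (j : Fin n) :
    (layoutEquiv n m r (Sum.inl (Sum.inr (a, j)))).1 = v0Idx n r a j := by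
  simp [layoutEquiv, v0Idx]; ring

/-- Layout of `(U_k)_{ai}`. [cite: BlaserIkenmeyerJindalLysikov2018, Obs. 17] -/
@[simp] theorem layoutEquiv_u (k : Fin m) (a i : Fin n) :
    (layoutEquiv n m r (Sum.inr (Sum.inl (Sum.inl (k, a, i))))).1 = uIdx n r k a i := by
  simp [layoutEquiv, uIdx]; ring

/-- Layout of `(V_k)_{aj}`. [cite: BlaserIkenmeyerJindalLysikov2018, Obs. 17] -/
@[simp] theorem layoutEquiv_v (k : Fin m) (a j : Fin n) :
    (layoutEquiv n m r (Sum.inr (Sum.inl (Sum.inr (k, a, j))))).1 = vIdx n m r k a j := by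
  simp [layoutEquiv, vIdx]; ring

/-- Layout of `z_k`. [cite: BlaserIkenmeyerJindalLysikov2018, Obs. 17] -/
@[simp] theorem layoutEquiv_z (k : Fin m) :
    (layoutEquiv n m r (Sum.inr (Sum.inr k))).1 = zIdx n m r k := by
  simp [layoutEquiv, zIdx]; ring

variable {n m r}

/-- `varP` at a laid-out parameter is the variable, over `K`. [cite: Burgisser2000, Def. 2.1] -/
private theorem map_varP_layout (q : Lemma16Params n m n r) :
    map (Int.castRingHom K) (varP (nVar n m r) (layoutEquiv n m r q).1) = X (layoutEquiv n m r q) := by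
  rw [varP_of_lt (layoutEquiv n m r q).isLt, map_X]

/-- **The coordinate polynomial of a position is the laid-out coordinate of `g`**:
`coordPoly (posEquiv v) = rename layoutEquiv (lemma16Poly v)` (read over `K`).
[cite: BlaserIkenmeyerJindalLysikov2018, Lemma 16 and Obs. 17 (g as a polynomial map)] -/
theorem map_coordPoly_posEquiv (v : Option (Fin m) × Fin n × Fin n) :
    map (Int.castRingHom K) (coordPoly n m r (posEquiv n m v).1) =
      rename (layoutEquiv n m r) (lemma16Poly K n m n r v) := by
  obtain ⟨hd, hbm, hcm⟩ := posEquiv_div_mod (n := n) (m := m) v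
  obtain ⟨h, i, j⟩ := v
  simp only at hd hbm hcm
  have hu0 : ∀ a : Fin r, map (Int.castRingHom K) (varP (nVar n m r) (u0Idx n a i)) =
      X (layoutEquiv n m r (Sum.inl (Sum.inl (a, i)))) := fun a => by
    rw [← map_varP_layout K, layoutEquiv_u0]
  have hv0 : ∀ a : Fin r, map (Int.castRingHom K) (varP (nVar n m r) (v0Idx n r a j)) =
      X (layoutEquiv n m r (Sum.inl (Sum.inr (a, j)))) := fun a => by
    rw [← map_varP_layout K, layoutEquiv_v0]
  have hu : ∀ (k : Fin m) (a : Fin n), map (Int.castRingHom K) (varP (nVar n m r) (uIdx n r k a i)) =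
      X (layoutEquiv n m r (Sum.inr (Sum.inl (Sum.inl (k, a, i))))) := fun k a => by
    rw [← map_varP_layout K, layoutEquiv_u]
  have hv : ∀ (k : Fin m) (a : Fin n), map (Int.castRingHom K) (varP (nVar n m r) (vIdx n m r k a j)) =
      X (layoutEquiv n m r (Sum.inr (Sum.inl (Sum.inr (k, a, j))))) := fun k a => by
    rw [← map_varP_layout K, layoutEquiv_v]
  have hz : ∀ k : Fin m, map (Int.castRingHom K) (varP (nVar n m r) (zIdx n m r k)) =
      X (layoutEquiv n m r (Sum.inr (Sum.inr k))) := fun k => by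
    rw [← map_varP_layout K, layoutEquiv_z]
  unfold coordPoly
  rw [hd, hbm, hcm]
  cases h with
  | none =>
    rw [sliceIdx, if_pos rfl]
    simp only [map_sub, map_sum, map_mul, hu0, hv0, hu, hv, hz, lemma16Poly, rename_X, Finset.mul_sum, mul_assoc]
  | some k =>
    rw [sliceIdx, if_neg (Nat.succ_ne_zero _), Nat.add_sub_cancel]
    simp only [map_sum, map_mul, hu, hv, lemma16Poly, rename_X]

/-- **The guessed polynomial read over `K` in the tensor coordinates**: `blockPoly` with its input
positions renamed to coordinates `(h, i, j)` and its integer coefficients cast to `K`.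
[cite: BlaserIkenmeyerJindalLysikov2018, Thm. 4 (proof: "a polynomial p computed by the circuit")] -/
def tensorPoly (B : KBlock) : MvPolynomial (Option (Fin m) × Fin n × Fin n) K :=
  rename (posEquiv n m).symm (map (Int.castRingHom K) (blockPoly (nPos n m) B))

/-- **The chart test over `K` is `p ∘ g` laid out**: `map (chartCircuit B).eval =
rename layoutEquiv (p ∘ g)` with `p = tensorPoly B`.
[cite: BlaserIkenmeyerJindalLysikov2018, Thm. 4 (proof, step (2)) and Lemma 16] -/
theorem map_eval_chartCircuit (B : KBlock) :
    map (Int.castRingHom K) (chartCircuit n m r B).eval =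
      rename (layoutEquiv n m r) (bind₁ (lemma16Poly K n m n r) (tensorPoly (n := n) (m := m) K B)) := by
  rw [eval_chartCircuit, aeval_eq_bind₁, map_bind₁, tensorPoly, rename_bind₁, bind₁_rename]
  have hfg : (fun i : Fin (nPos n m) => map (Int.castRingHom K) (coordPoly n m r i.1)) =
      ((fun i => rename (layoutEquiv n m r) (lemma16Poly K n m n r i)) ∘ (posEquiv n m).symm) := by
    funext i
    simp only [Function.comp_apply]
    have h := map_coordPoly_posEquiv (r := r) K ((posEquiv n m).symm i)
    rwa [Equiv.apply_symm_apply] at h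
  rw [hfg]

variable [CharZero K]

/-- **The chart-test circuit vanishes iff `p ∘ g = 0` as a polynomial over `K`** (characteristic
`0`: the integer identity and the `K`-identity are equivalent). [cite: BlaserIkenmeyerJindalLysikov2018, Thm. 4 (proof, step (2): "Decide whether p(g) = 0 using polynomial identity testing")] -/
theorem eval_chartCircuit_eq_zero_iff (B : KBlock) :
    (chartCircuit n m r B).eval = 0 ↔
      bind₁ (lemma16Poly K n m n r) (tensorPoly (n := n) (m := m) K B) = 0 := by
  constructor
  · intro h
    have h' := map_eval_chartCircuit (n := n) (m := m) (r := r) K B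
    rw [h, map_zero] at h'
    exact rename_injective _ (layoutEquiv n m r).injective (by rw [← h', map_zero])
  · intro h
    apply map_injective (Int.castRingHom K) Int.cast_injective
    rw [map_eval_chartCircuit, h, map_zero, map_zero]

/-- **The chart test vanishes iff the guessed polynomial vanishes on the image of `g`** (the
vanishing ideal of `C^{n,m,n}_r`, `K` infinite). [cite: BlaserIkenmeyerJindalLysikov2018, Lemma 16 and Obs. 17] -/
theorem eval_chartCircuit_eq_zero_iff_mem (B : KBlock) :
    (chartCircuit n m r B).eval = 0 ↔ tensorPoly (n := n) (m := m) K B ∈ lemma16VanishingIdeal K n m n r := by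
  haveI : Infinite K := Infinite.of_injective _ Nat.cast_injective
  rw [eval_chartCircuit_eq_zero_iff K, mem_lemma16VanishingIdeal_iff]

end Link

/-! ### §4. Soundness and completeness of the two tests, at the level of guessed blocks -/

section Tests

variable (K : Type u) [Field K] {n m r : ℕ}

/-- **Reading the block polynomial at the instance entries, in `K`**: the integer value tested by
the evaluation circuit, cast to `K`, is the value of the guessed polynomial (read in the tensor
coordinates) at the instance tensor. [cite: BlaserIkenmeyerJindalLysikov2018, Thm. 4 (proof, step (3): "Check whether p(T_φ) ≠ 0")] -/
theorem cast_eval_blockPoly (l : List ℤ) (Q : MvPolynomial (Fin (nPos n m)) ℤ) :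
    ((eval (fun i : Fin (nPos n m) => entryFn l i.1) Q : ℤ) : K) =
      eval (tensorPoint K (slice₀OfList K n l) (slicesOfList K n m l))
        (rename (posEquiv n m).symm (map (Int.castRingHom K) Q)) := by
  have hpt : tensorPoint K (slice₀OfList K n l) (slicesOfList K n m l) =
      (Int.castRingHom K) ∘ fun v => entryFn l (posEquiv n m v).1 := funext (tensorPoint_ofList K l)
  have hev : eval (fun i : Fin (nPos n m) => entryFn l i.1) Q =
      eval (fun v : Option (Fin m) × Fin n × Fin n => entryFn l (posEquiv n m v).1) (rename (posEquiv n m).symm Q) := by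
    rw [MvPolynomial.eval_rename]
    have hfun : ((fun v : Option (Fin m) × Fin n × Fin n => entryFn l (posEquiv n m v).1) ∘ (posEquiv n m).symm) =
        fun i : Fin (nPos n m) => entryFn l i.1 := by
      funext i
      simp only [Function.comp_apply, Equiv.apply_symm_apply]
    rw [hfun]
  rw [hpt, hev, ← map_rename, ← MvPolynomial.map_eval]
  rfl

variable [CharZero K]

/-- **SOUNDNESS of the two tests.** If the chart-test circuit of a guessed block computes `0` and its
evaluation circuit at the instance entries does not, then the instance tensor has border completion
rank `> r`: the guessed polynomial vanishes on the image of `g`, hence ("since `p` is a polynomial")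
on every tensor of border completion rank `≤ r` (Obs. 17, every slice of an `n × n` tensor having
rank `≤ n`), but not at the instance tensor. [cite: BlaserIkenmeyerJindalLysikov2018, Thm. 4 (proof: "The correctness follows from the construction") and Lemma 16] -/
theorem lt_borderCompletionRank_of_tests (l : List ℤ) (B : KBlock)
    (hchart : (chartCircuit n m r B).eval = 0)
    (heval : (evalCircuit (nPos n m) (entryFn l) B).eval ≠ 0) :
    r < borderCompletionRank (slice₀OfList K n l) (slicesOfList K n m l) := by
  haveI : Infinite K := Infinite.of_injective _ Nat.cast_injective
  have hmem := (eval_chartCircuit_eq_zero_iff_mem (n := n) (m := m) (r := r) K B).1 hchart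
  by_contra hle
  have hA : (slice₀OfList K n l, slicesOfList K n m l) ∈ bijlVariety K n m n r :=
    ⟨le_of_not_gt hle, fun k => Matrix.rank_le_width _⟩
  have h0 : eval (tensorPoint K (slice₀OfList K n l) (slicesOfList K n m l))
      (tensorPoly (n := n) (m := m) K B) = 0 :=
    eval_eq_zero_of_mem_bijlVariety (K := K) hA hmem
  rw [tensorPoly, ← cast_eval_blockPoly K l, Int.cast_eq_zero, ← eval_evalCircuit_eq_zero_iff] at h0
  exact heval h0

/-- **COMPLETENESS of the two tests.** A typed natural proof `IsBorderCRProof K A₀ A r s p` for the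
instance tensor — "a polynomial that vanishes on all tensors of border completion rank `≤ r` but not
on `T_φ` and that has polynomial-size arithmetic circuits" (constant-free, fan-in two, size `≤ s`)
— descends to a guessed block of length `≤ s + 1` whose references stay inside its use and which
passes both tests (the image of `g` consists of tensors of completion rank, hence border completion
rank, `≤ r`, Lemma 16). [cite: BlaserIkenmeyerJindalLysikov2018, Thm. 4 (proof: "Such a polynomial is guaranteed to exist by assumption") and Lemma 16] -/
theorem exists_block_of_isBorderCRProof (l : List ℤ) {s : ℕ}
    {p : MvPolynomial (Option (Fin m) × Fin n × Fin n) K}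
    (hp : IsBorderCRProof K (slice₀OfList K n l) (slicesOfList K n m l) r s p) :
    ∃ B : KBlock, B.length ≤ s + 1 ∧
      (∀ g ∈ B, g.a.idx < nPos n m + B.length ∧ g.b.idx < nPos n m + B.length) ∧
      (chartCircuit n m r B).eval = 0 ∧
      (evalCircuit (nPos n m) (entryFn l) B).eval ≠ 0 := by
  haveI : Infinite K := Infinite.of_injective _ Nat.cast_injective
  obtain ⟨hne, hvan, P₀, h2, hs, hcomp, hsize⟩ := hp
  set e := posEquiv n m with he
  obtain ⟨B, hlen, hidx, hmap⟩ := exists_kblock_of_circuit (P₀.rename e) (h2.rename _) (hs.rename _)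
  have hQ : map (Int.castRingHom K) (blockPoly (nPos n m) B) = rename e p := by
    rw [hmap, eval_rename_apply, hcomp]
  have hPp : tensorPoly (n := n) (m := m) K B = p := by
    rw [tensorPoly, hQ, rename_rename, he, Equiv.symm_comp_self, rename_id_apply]
  refine ⟨B, by rw [hlen, size_rename]; omega, hidx, ?_, ?_⟩
  · refine (eval_chartCircuit_eq_zero_iff_mem (n := n) (m := m) (r := r) K B).2 ?_
    rw [hPp]
    intro U₀ V₀ U V z
    exact hvan _ _ (lemma16Map_mem_bijlVariety (K := K) U₀ V₀ U V z).1
  · intro h0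
    rw [eval_evalCircuit_eq_zero_iff] at h0
    apply hne
    rw [← hPp, tensorPoly, ← cast_eval_blockPoly K l, h0, Int.cast_zero]

end Tests

/-! ### §5. The Max-2-SAT end: padding by tautological clauses, the sign pattern of `T_φ`, and
membership read as border completion rank -/

section MaxTwoSat

open Literature.Computability.Complexity BIJL18NPHard
open CNF

/-- **Padding a 2-CNF by `n₀` tautological clauses `(x₀ ∨ ¬x₀)`**: every assignment satisfies
exactly `n₀` more clauses, so `(φ, b) ∈` Max-2-SAT iff `(pad φ, b + n₀) ∈` Max-2-SAT, and the
tensor `T_{pad φ}` has side `2(|φ| + n₀) ≥ n₀` — this replaces print's "let `n` be large enough such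
that for all tensors under consideration, there is an algebraic `poly(n)`-natural proof" (the typed
hypothesis yields natural proofs only from some size `n₀` on).
[cite: BlaserIkenmeyerJindalLysikov2018, Thm. 4 (proof, first paragraph)] -/
def padCNF (n₀ : ℕ) (φ : CNF ℕ) : CNF ℕ := φ ++ List.replicate n₀ [(0, true), (0, false)]

/-- Length of the padded CNF. [cite: BlaserIkenmeyerJindalLysikov2018, Thm. 4 (proof)] -/
@[simp] theorem length_padCNF (n₀ : ℕ) (φ : CNF ℕ) : (padCNF n₀ φ).length = φ.length + n₀ := by
  rw [padCNF, List.length_append, List.length_replicate]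

/-- The padding clause is a tautology. [folklore] -/
private theorem eval_padClause (σ : ℕ → Bool) : Clause.eval σ [(0, true), (0, false)] = true := by
  cases h : σ 0 <;> simp [Clause.eval, Literal.eval, h]

/-- **The objective shifts by `n₀`.** [cite: GareyJohnsonStockmeyer1976, §1 (MAX 2-SAT)] -/
theorem numSatClauses_padCNF (n₀ : ℕ) (φ : CNF ℕ) (σ : ℕ → Bool) :
    (padCNF n₀ φ).numSatClauses σ = φ.numSatClauses σ + n₀ := by
  rw [padCNF, numSatClauses_append]
  congr 1
  unfold numSatClauses
  rw [List.countP_replicate, if_pos (eval_padClause σ)]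

/-- Padding keeps width exactly two. [cite: GareyJohnson1979, LO5] -/
theorem isWidthEq_padCNF_iff (n₀ : ℕ) (φ : CNF ℕ) : IsWidthEq 2 (padCNF n₀ φ) ↔ IsWidthEq 2 φ := by
  unfold IsWidthEq padCNF
  simp only [List.mem_append, List.mem_replicate]
  constructor
  · exact fun h c hc => h c (Or.inl hc)
  · rintro h c (hc | ⟨-, rfl⟩)
    · exact h c hc
    · rfl

/-- **Max-2-SAT membership is invariant under padding.** [cite: BlaserIkenmeyerJindalLysikov2018, Thm. 4 (proof)] -/
theorem exists_numSatClauses_padCNF_iff (n₀ : ℕ) (φ : CNF ℕ) (b : ℕ) :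
    (∃ σ : ℕ → Bool, b + n₀ ≤ (padCNF n₀ φ).numSatClauses σ) ↔ ∃ σ : ℕ → Bool, b ≤ φ.numSatClauses σ := by
  simp only [numSatClauses_padCNF, Nat.add_le_add_iff_right]

/-- Every entry of the Thm-3 tensor is `0`, `1` or `−1`. [cite: BlaserIkenmeyerJindalLysikov2018, Thm. 4 ("a tensor t with coefficients in {−1, 0, 1}")] -/
theorem entryInt_sign (φ : CNF ℕ) (h i j : ℕ) :
    entryInt φ h i j = 0 ∨ entryInt φ h i j = 1 ∨ entryInt φ h i j = -1 := by
  unfold entryInt a0Int sliceInt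
  split_ifs <;> simp

/-- Every position of the entry list reads `0`, `1` or `−1` (junk `0` beyond it).
[cite: BlaserIkenmeyerJindalLysikov2018, Thm. 4 ("coefficients in {−1, 0, 1}")] -/
theorem getD_entries_sign (φ : CNF ℕ) (v : ℕ) :
    (entries φ).getD v 0 = 0 ∨ (entries φ).getD v 0 = 1 ∨ (entries φ).getD v 0 = -1 := by
  rw [entries, List.getD_eq_getElem?_getD, List.getElem?_map]
  by_cases hv : v < (tOf φ + 1) * (nOf φ * nOf φ)
  · rw [List.getElem?_range hv]
    exact entryInt_sign φ _ _ _
  · rw [List.getElem?_eq_none (by simpa using hv)]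
    simp

variable (K : Type u) [Field K]

/-- **The coded tensor `T_φ` is a `{−1, 0, 1}`-tensor.** [cite: BlaserIkenmeyerJindalLysikov2018, Thm. 4 ("a tensor t ∈ K^{n×n×m} with coefficients in {−1, 0, 1}")] -/
theorem tensorPoint_entries_sign (φ : CNF ℕ) (v : Option (Fin (tOf φ)) × Fin (nOf φ) × Fin (nOf φ)) :
    tensorPoint K (slice₀OfList K (nOf φ) (entries φ)) (slicesOfList K (nOf φ) (tOf φ) (entries φ)) v = 0 ∨
    tensorPoint K (slice₀OfList K (nOf φ) (entries φ)) (slicesOfList K (nOf φ) (tOf φ) (entries φ)) v = 1 ∨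
    tensorPoint K (slice₀OfList K (nOf φ) (entries φ)) (slicesOfList K (nOf φ) (tOf φ) (entries φ)) v = -1 := by
  rw [tensorPoint_ofList K, entryFn]
  rcases getD_entries_sign φ (posEquiv (nOf φ) (tOf φ) v).1 with h | h | h <;> rw [h] <;> simp

/-- **"`b` clauses of `φ` cannot be satisfied" read as border completion rank** (Thm. 3 / Lemma 14
on the coded tensor): for a 2-CNF `φ` with `s` clauses and `b ≤ 2s`, no assignment satisfies `b`
clauses iff `\underline{CR}(T_φ) > 2s − b`. [cite: BlaserIkenmeyerJindalLysikov2018, Thm. 4 (proof: "We want to check whether every assignment satisfies < b clauses of ϕ … Let T_φ …") and Lemma 14] -/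
theorem not_exists_numSatClauses_iff_lt_borderCompletionRank {φ : CNF ℕ} {b : ℕ} (h2 : IsWidthEq 2 φ)
    (hb : b ≤ 2 * φ.length) :
    (¬ ∃ σ : ℕ → Bool, b ≤ φ.numSatClauses σ) ↔
      2 * φ.length - b < borderCompletionRank (slice₀OfList K (nOf φ) (entries φ))
        (slicesOfList K (nOf φ) (tOf φ) (entries φ)) := by
  have h := encode_reduceT_mem_borderCRLanguage_iff K (φ, b)
  have hr : reduceT (φ, b) = instOf φ b := if_pos ⟨h2, hb⟩
  rw [hr, mem_borderCRLanguage_iff, and_iff_right (wellFormedInst_instOf φ b)] at h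
  change borderCompletionRank (slice₀OfList K (nOf φ) (entries φ)) (slicesOfList K (nOf φ) (tOf φ) (entries φ)) ≤
      2 * φ.length - b ↔ IsWidthEq 2 φ ∧ ∃ σ : ℕ → Bool, b ≤ φ.numSatClauses σ at h
  rw [← not_le]
  exact not_congr (h.trans (and_iff_right h2)).symm

variable [CharZero K]

/-- **SOUNDNESS at the Max-2-SAT end.** For a 2-CNF `φ` and `b ≤ 2|φ|`, padded by `n₀` clauses to
`φ'` with `b' = b + n₀` and coded as `(n, m, entries, r) = instOf φ' b'`: if a guessed block passes
both tests for this instance, then no assignment satisfies `b` clauses of `φ`.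
The statement is field-free; the rank is read over `ℚ`.
[cite: BlaserIkenmeyerJindalLysikov2018, Thm. 4 (proof: "If yes, then accept")] -/
theorem not_exists_numSatClauses_of_tests {φ : CNF ℕ} {b : ℕ} (n₀ : ℕ) (h2 : IsWidthEq 2 φ)
    (hb : b ≤ 2 * φ.length) (B : KBlock)
    (hchart : (chartCircuit (nOf (padCNF n₀ φ)) (tOf (padCNF n₀ φ))
      (2 * (padCNF n₀ φ).length - (b + n₀)) B).eval = 0)
    (heval : (evalCircuit (nPos (nOf (padCNF n₀ φ)) (tOf (padCNF n₀ φ)))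
      (entryFn (entries (padCNF n₀ φ))) B).eval ≠ 0) :
    ¬ ∃ σ : ℕ → Bool, b ≤ φ.numSatClauses σ := by
  rw [← exists_numSatClauses_padCNF_iff n₀,
    not_exists_numSatClauses_iff_lt_borderCompletionRank ℚ ((isWidthEq_padCNF_iff n₀ φ).2 h2)
      (by rw [length_padCNF]; omega)]
  exact lt_borderCompletionRank_of_tests ℚ _ B hchart heval

/-- **COMPLETENESS at the Max-2-SAT end** under the natural-proof hypothesis (the negation of the
conclusion of `BIJL2018_thm4`: from size `n₀` on, every `{−1,0,1}`-tensor of border completion rank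
`> r` has a constant-free natural proof of size `≤ n^c₀ + c₀`): if no assignment satisfies `b ≤ 2|φ|`
clauses of the 2-CNF `φ`, the padded coded instance has a short guessed block passing both tests.
[cite: BlaserIkenmeyerJindalLysikov2018, Thm. 4 (proof: "let n be large enough such that for all tensors under consideration, there is an algebraic poly(n)-natural proof")] -/
theorem exists_block_of_not_exists_numSatClauses {c₀ n₀ : ℕ}
    (hnat : ∀ n : ℕ, n₀ ≤ n → ∀ (m : ℕ) (A₀ : Matrix (Fin n) (Fin n) K) (A : Fin m → Matrix (Fin n) (Fin n) K)
      (r : ℕ), (∀ v, tensorPoint K A₀ A v = 0 ∨ tensorPoint K A₀ A v = 1 ∨ tensorPoint K A₀ A v = -1) →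
        r < borderCompletionRank A₀ A → ∃ p, IsBorderCRProof K A₀ A r (n ^ c₀ + c₀) p)
    {φ : CNF ℕ} {b : ℕ} (h2 : IsWidthEq 2 φ) (hb : b ≤ 2 * φ.length)
    (hno : ¬ ∃ σ : ℕ → Bool, b ≤ φ.numSatClauses σ) :
    ∃ B : KBlock, B.length ≤ nOf (padCNF n₀ φ) ^ c₀ + c₀ + 1 ∧
      (∀ g ∈ B, g.a.idx < nPos (nOf (padCNF n₀ φ)) (tOf (padCNF n₀ φ)) + B.length ∧
        g.b.idx < nPos (nOf (padCNF n₀ φ)) (tOf (padCNF n₀ φ)) + B.length) ∧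
      (chartCircuit (nOf (padCNF n₀ φ)) (tOf (padCNF n₀ φ)) (2 * (padCNF n₀ φ).length - (b + n₀)) B).eval = 0 ∧
      (evalCircuit (nPos (nOf (padCNF n₀ φ)) (tOf (padCNF n₀ φ)))
        (entryFn (entries (padCNF n₀ φ))) B).eval ≠ 0 := by
  set φ' := padCNF n₀ φ with hφ'
  have h2' : IsWidthEq 2 φ' := (isWidthEq_padCNF_iff n₀ φ).2 h2
  have hb' : b + n₀ ≤ 2 * φ'.length := by rw [hφ', length_padCNF]; omega
  have hno' : ¬ ∃ σ : ℕ → Bool, b + n₀ ≤ φ'.numSatClauses σ := by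
    rwa [hφ', exists_numSatClauses_padCNF_iff]
  have hlt := (not_exists_numSatClauses_iff_lt_borderCompletionRank K h2' hb').1 hno'
  have hn : n₀ ≤ nOf φ' := by rw [nOf, hφ', length_padCNF]; omega
  obtain ⟨p, hp⟩ := hnat (nOf φ') hn (tOf φ') _ _ _ (tensorPoint_entries_sign K φ') hlt
  exact exists_block_of_isBorderCRProof K (entries φ') hp

end MaxTwoSat

/-! ### §6. Any characteristic: the two tests read modulo the characteristic

Appended by val-lit p7 g7 for the positive-characteristic half of Thm 4 (t21 g9's identity test
modulo a fixed prime): over a field `K` of characteristic `p` the chart test is the integer identity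
`chartCircuit ≡ 0` READ MODULO `p` and the evaluation test is the integer value read modulo `p`; the
block-level soundness / completeness of §4 hold over every INFINITE field in this form. -/

section AnyChar

open Literature.Computability.Complexity BIJL18NPHard
open CNF

variable (K : Type u) [Field K] {n m r : ℕ}

/-- **The chart test over `K`**: the chart-test identity read over `K` holds iff `p ∘ g = 0` over `K`
(no assumption on the characteristic). [cite: BlaserIkenmeyerJindalLysikov2018, Thm. 4 (proof, step (2))] -/
theorem map_eval_chartCircuit_eq_zero_iff (B : KBlock) :
    map (Int.castRingHom K) (chartCircuit n m r B).eval = 0 ↔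
      bind₁ (lemma16Poly K n m n r) (tensorPoly (n := n) (m := m) K B) = 0 := by
  rw [map_eval_chartCircuit]
  constructor
  · intro h
    exact rename_injective _ (layoutEquiv n m r).injective (by rw [h, map_zero])
  · intro h
    rw [h, map_zero]

/-- The chart test over an infinite `K` holds iff the guessed polynomial vanishes on the image of `g`.
[cite: BlaserIkenmeyerJindalLysikov2018, Lemma 16 and Obs. 17] -/
theorem map_eval_chartCircuit_eq_zero_iff_mem [Infinite K] (B : KBlock) :
    map (Int.castRingHom K) (chartCircuit n m r B).eval = 0 ↔
      tensorPoly (n := n) (m := m) K B ∈ lemma16VanishingIdeal K n m n r := by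
  rw [map_eval_chartCircuit_eq_zero_iff K, mem_lemma16VanishingIdeal_iff]

/-- **SOUNDNESS over any infinite field**: if the chart-test identity holds over `K` and the integer
value of the evaluation test is nonzero in `K`, the instance tensor has border completion rank `> r`.
[cite: BlaserIkenmeyerJindalLysikov2018, Thm. 4 (proof) and Lemma 16] -/
theorem lt_borderCompletionRank_of_tests_map [Infinite K] (l : List ℤ) (B : KBlock)
    (hchart : map (Int.castRingHom K) (chartCircuit n m r B).eval = 0)
    (heval : ((eval (fun i : Fin (nPos n m) => entryFn l i.1) (blockPoly (nPos n m) B) : ℤ) : K) ≠ 0) :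
    r < borderCompletionRank (slice₀OfList K n l) (slicesOfList K n m l) := by
  have hmem := (map_eval_chartCircuit_eq_zero_iff_mem (n := n) (m := m) (r := r) K B).1 hchart
  by_contra hle
  have hA : (slice₀OfList K n l, slicesOfList K n m l) ∈ bijlVariety K n m n r :=
    ⟨le_of_not_gt hle, fun k => Matrix.rank_le_width _⟩
  have h0 : eval (tensorPoint K (slice₀OfList K n l) (slicesOfList K n m l))
      (tensorPoly (n := n) (m := m) K B) = 0 :=
    eval_eq_zero_of_mem_bijlVariety (K := K) hA hmem
  rw [tensorPoly, ← cast_eval_blockPoly K l] at h0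
  exact heval h0

/-- **COMPLETENESS over any infinite field**: a typed natural proof of the instance tensor descends to
a guessed block of length `≤ s + 1` whose chart-test identity holds over `K` and whose evaluation
value is nonzero in `K`. [cite: BlaserIkenmeyerJindalLysikov2018, Thm. 4 (proof) and Lemma 16] -/
theorem exists_block_of_isBorderCRProof_map [Infinite K] (l : List ℤ) {s : ℕ}
    {p : MvPolynomial (Option (Fin m) × Fin n × Fin n) K}
    (hp : IsBorderCRProof K (slice₀OfList K n l) (slicesOfList K n m l) r s p) :
    ∃ B : KBlock, B.length ≤ s + 1 ∧
      (∀ g ∈ B, g.a.idx < nPos n m + B.length ∧ g.b.idx < nPos n m + B.length) ∧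
      map (Int.castRingHom K) (chartCircuit n m r B).eval = 0 ∧
      ((eval (fun i : Fin (nPos n m) => entryFn l i.1) (blockPoly (nPos n m) B) : ℤ) : K) ≠ 0 := by
  obtain ⟨hne, hvan, P₀, h2, hs, hcomp, hsize⟩ := hp
  set e := posEquiv n m with he
  obtain ⟨B, hlen, hidx, hmap⟩ := exists_kblock_of_circuit (P₀.rename e) (h2.rename _) (hs.rename _)
  have hQ : map (Int.castRingHom K) (blockPoly (nPos n m) B) = rename e p := by
    rw [hmap, eval_rename_apply, hcomp]
  have hPp : tensorPoly (n := n) (m := m) K B = p := by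
    rw [tensorPoly, hQ, rename_rename, he, Equiv.symm_comp_self, rename_id_apply]
  refine ⟨B, by rw [hlen, size_rename]; omega, hidx, ?_, ?_⟩
  · refine (map_eval_chartCircuit_eq_zero_iff_mem (n := n) (m := m) (r := r) K B).2 ?_
    rw [hPp]
    intro U₀ V₀ U V z
    exact hvan _ _ (lemma16Map_mem_bijlVariety (K := K) U₀ V₀ U V z).1
  · intro h0
    apply hne
    rw [← hPp, tensorPoly, ← cast_eval_blockPoly K l, h0]

variable (p : ℕ) [CharP K p]

/-- The integer scalars of `K` factor through `ZMod p` (`p` the characteristic). [folklore] -/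
private theorem intCastRingHom_eq_comp :
    Int.castRingHom K = (ZMod.castHom (dvd_refl p) K).comp (Int.castRingHom (ZMod p)) :=
  RingHom.ext_int _ _

/-- **In characteristic `p`, an integer identity read over `K` is the identity read modulo `p`.**
[cite: BlaserIkenmeyerJindalLysikov2018, Thm. 4 (proof, step (2): "using polynomial identity testing")] -/
theorem map_intCast_eq_zero_iff_zmod {σ : Type*} (Q : MvPolynomial σ ℤ) :
    map (Int.castRingHom K) Q = 0 ↔ map (Int.castRingHom (ZMod p)) Q = 0 := by
  rw [intCastRingHom_eq_comp K p, ← map_map]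
  constructor
  · intro h
    exact map_injective _ (ZMod.castHom_injective K) (by rw [h, map_zero])
  · intro h
    rw [h, map_zero]

/-- **In characteristic `p`, an integer is nonzero in `K` iff it is nonzero modulo `p`.**
[cite: BlaserIkenmeyerJindalLysikov2018, Thm. 4 (proof, step (3))] -/
theorem intCast_ne_zero_iff_zmod (z : ℤ) : (z : K) ≠ 0 ↔ (z : ZMod p) ≠ 0 := by
  rw [← map_intCast (Int.castRingHom K) z, intCastRingHom_eq_comp K p, RingHom.comp_apply,
    map_ne_zero_iff _ (ZMod.castHom_injective K), map_intCast]

variable [Infinite K]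

/-- **SOUNDNESS in characteristic `p`**: the chart-test identity modulo `p` and a nonzero evaluation
value modulo `p` force border completion rank `> r` of the instance tensor over `K`.
[cite: BlaserIkenmeyerJindalLysikov2018, Thm. 4 (proof) and Lemma 16] -/
theorem lt_borderCompletionRank_of_tests_zmod (l : List ℤ) (B : KBlock)
    (hchart : map (Int.castRingHom (ZMod p)) (chartCircuit n m r B).eval = 0)
    (heval : ((eval (fun i : Fin (nPos n m) => entryFn l i.1) (blockPoly (nPos n m) B) : ℤ) : ZMod p) ≠ 0) :
    r < borderCompletionRank (slice₀OfList K n l) (slicesOfList K n m l) :=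
  lt_borderCompletionRank_of_tests_map K l B ((map_intCast_eq_zero_iff_zmod K p _).2 hchart)
    ((intCast_ne_zero_iff_zmod K p _).2 heval)

/-- **COMPLETENESS in characteristic `p`**: a typed natural proof over `K` descends to a guessed block
passing the chart test modulo `p` and the evaluation test modulo `p`.
[cite: BlaserIkenmeyerJindalLysikov2018, Thm. 4 (proof) and Lemma 16] -/
theorem exists_block_of_isBorderCRProof_zmod (l : List ℤ) {s : ℕ}
    {q : MvPolynomial (Option (Fin m) × Fin n × Fin n) K}
    (hq : IsBorderCRProof K (slice₀OfList K n l) (slicesOfList K n m l) r s q) :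
    ∃ B : KBlock, B.length ≤ s + 1 ∧
      (∀ g ∈ B, g.a.idx < nPos n m + B.length ∧ g.b.idx < nPos n m + B.length) ∧
      map (Int.castRingHom (ZMod p)) (chartCircuit n m r B).eval = 0 ∧
      ((eval (fun i : Fin (nPos n m) => entryFn l i.1) (blockPoly (nPos n m) B) : ℤ) : ZMod p) ≠ 0 := by
  obtain ⟨B, hlen, hidx, hchart, heval⟩ := exists_block_of_isBorderCRProof_map K l hq
  exact ⟨B, hlen, hidx, (map_intCast_eq_zero_iff_zmod K p _).1 hchart, (intCast_ne_zero_iff_zmod K p _).1 heval⟩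

/-- **SOUNDNESS at the Max-2-SAT end in characteristic `p`** (padded coded instance; Lemma 14 holds
over every field; the rank is read over any infinite field `K` of characteristic `p`, given as an
argument). [cite: BlaserIkenmeyerJindalLysikov2018, Thm. 4 (proof) and Lemma 14] -/
theorem not_exists_numSatClauses_of_tests_zmod (K : Type u) [Field K] [CharP K p] [Infinite K]
    {φ : CNF ℕ} {b : ℕ} (n₀ : ℕ) (h2 : IsWidthEq 2 φ)
    (hb : b ≤ 2 * φ.length) (B : KBlock)
    (hchart : map (Int.castRingHom (ZMod p)) (chartCircuit (nOf (padCNF n₀ φ))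
      (tOf (padCNF n₀ φ)) (2 * (padCNF n₀ φ).length - (b + n₀)) B).eval = 0)
    (heval : ((eval (fun i : Fin (nPos (nOf (padCNF n₀ φ)) (tOf (padCNF n₀ φ))) =>
        entryFn (entries (padCNF n₀ φ)) i.1)
      (blockPoly (nPos (nOf (padCNF n₀ φ)) (tOf (padCNF n₀ φ))) B) : ℤ) :
        ZMod p) ≠ 0) :
    ¬ ∃ σ : ℕ → Bool, b ≤ φ.numSatClauses σ := by
  rw [← exists_numSatClauses_padCNF_iff n₀,
    not_exists_numSatClauses_iff_lt_borderCompletionRank K ((isWidthEq_padCNF_iff n₀ φ).2 h2)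
      (by rw [length_padCNF]; omega)]
  exact lt_borderCompletionRank_of_tests_zmod K p _ B hchart heval

/-- **COMPLETENESS at the Max-2-SAT end in characteristic `p`** under the natural-proof hypothesis over
`K`. [cite: BlaserIkenmeyerJindalLysikov2018, Thm. 4 (proof)] -/
theorem exists_block_of_not_exists_numSatClauses_zmod {c₀ n₀ : ℕ}
    (hnat : ∀ n : ℕ, n₀ ≤ n → ∀ (m : ℕ) (A₀ : Matrix (Fin n) (Fin n) K) (A : Fin m → Matrix (Fin n) (Fin n) K)
      (r : ℕ), (∀ v, tensorPoint K A₀ A v = 0 ∨ tensorPoint K A₀ A v = 1 ∨ tensorPoint K A₀ A v = -1) →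
        r < borderCompletionRank A₀ A → ∃ q, IsBorderCRProof K A₀ A r (n ^ c₀ + c₀) q)
    {φ : CNF ℕ} {b : ℕ} (h2 : IsWidthEq 2 φ) (hb : b ≤ 2 * φ.length)
    (hno : ¬ ∃ σ : ℕ → Bool, b ≤ φ.numSatClauses σ) :
    ∃ B : KBlock, B.length ≤ nOf (padCNF n₀ φ) ^ c₀ + c₀ + 1 ∧
      (∀ g ∈ B, g.a.idx < nPos (nOf (padCNF n₀ φ)) (tOf (padCNF n₀ φ)) + B.length ∧
        g.b.idx < nPos (nOf (padCNF n₀ φ)) (tOf (padCNF n₀ φ)) + B.length) ∧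
      map (Int.castRingHom (ZMod p)) (chartCircuit (nOf (padCNF n₀ φ))
        (tOf (padCNF n₀ φ)) (2 * (padCNF n₀ φ).length - (b + n₀)) B).eval = 0 ∧
      ((eval (fun i : Fin (nPos (nOf (padCNF n₀ φ)) (tOf (padCNF n₀ φ))) =>
          entryFn (entries (padCNF n₀ φ)) i.1)
        (blockPoly (nPos (nOf (padCNF n₀ φ)) (tOf (padCNF n₀ φ))) B) : ℤ) :
          ZMod p) ≠ 0 := by
  set φ' := padCNF n₀ φ with hφ'
  have h2' : IsWidthEq 2 φ' := (isWidthEq_padCNF_iff n₀ φ).2 h2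
  have hb' : b + n₀ ≤ 2 * φ'.length := by rw [hφ', length_padCNF]; omega
  have hno' : ¬ ∃ σ : ℕ → Bool, b + n₀ ≤ φ'.numSatClauses σ := by
    rwa [hφ', exists_numSatClauses_padCNF_iff]
  have hlt := (not_exists_numSatClauses_iff_lt_borderCompletionRank K h2' hb').1 hno'
  have hn : n₀ ≤ nOf φ' := by rw [nOf, hφ', length_padCNF]; omega
  obtain ⟨q, hq⟩ := hnat (nOf φ') hn (tOf φ') _ _ _ (tensorPoint_entries_sign K φ') hlt
  exact exists_block_of_isBorderCRProof_zmod K p (entries φ') hq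

end AnyChar




end BIJL2018Thm4

end Literature.Barriers.ValiantsHypothesis
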